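import Summits.QuantumFields.BalabanUV.T4Continuum.Support.NE3SlicePoincareSkeleton
import Summits.QuantumFields.BalabanUV.T4Continuum.Support.NE3CovariantLandauKill
import Summits.QuantumFields.BalabanUV.T4Continuum.Support.NE3CovariantBlockPoincare
import Summits.QuantumFields.BalabanUV.T4Continuum.Support.NE3NestedBlockMeanBridge
import HarnessLib

/-!
# NE3SlicePoincareRemainderRho (T⁴ programme, node NE3, row K6 of the owner's ruling ρ-g22-2, part K6b-1 of the cut ρ-g23-3 §3) — THE `R_ρ`
# PAIRING OF THE S-BOUND: `|Σ_y hsR (ρ y) (psiExt M W (bmeanIterW L k W ζ′) y)|` IS `O(ε)·y²` THROUGH THE SPECTRAL ORTHOGONALITY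
# `Σ hsR ζ′ ρ = 0`, THE COVARIANT BLOCK POINCARÉ INEQUALITY (K2) AND THE NESTED-vs-SINGLE BLOCK-MEAN BRIDGE (J2)

NE3 (node U1b) formalisation swarm `b2b-balaban-t4-ne3-formalise-*`, leaf seat `b2b-balaban-t4-ne3-formalise-leaf-02` (gen 6), row **K6**
(assembly of the curved (P♮), booked → leaf-02 lineage; blueprint `HOME/t4/b2b-balaban-t4-ne3-p1/g23/D-ne3p1-g23-1.md` = ruling ρ-g23-3, §2(a)
«`R_ρ`»; disprover check D-ne3r2-g8-2 (2): `≤ 16ε(1 + 2√d·dθ∕ε + √(card n)·E_k∕ε)·y²`).  Over K2 `NE3CovariantBlockPoincare.sum_nhsNormSq_sub_combMean_le`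
(leaf-04), J2 `NE3NestedBlockMeanBridge.sum_nhsNormSq_bmeanIterW_sub_bmeanW_le` (NE3-R2 g8), K4-c's `NE3CovariantLandauKill.psiExt` (owner g23; rooted
at `btree`, ρ-g23-1 (J3) ≡ 0) and K6a `NE3SlicePoincareSkeleton.abs_sum_hsR_le` (Cauchy–Schwarz) BY NAME.  All [folklore], 0 sorry, 0 def:
§1 `psiExt` algebra: `psiExt_sub` (linear in `ψ`), `psiExt_block` (on the block of `z` it is `Ad (btree M W z y)⁻¹ (ψ z)`, `SkeletonLattice.cdiv_eq_of_repr`),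
   **`sum_nhsNormSq_psiExt_sub_psiExt`**: `Σ_{y∈periodBox(M·N)} nhsNormSq (psiExt M W ψ₁ y − psiExt M W ψ₂ y) = Σ_{z∈periodBox N} M^d·nhsNormSq (ψ₁ z − ψ₂ z)`
   (unitary `W`: the transport is an HS isometry; block tiling `sum_periodBox_blocks`, `card_periodBox`);
§2 **`sum_nhsNormSq_psiExt_bmeanW_sub_le`** = K2 tiled over the torus: `Σ_y nhsNormSq (psiExt M W (bmeanW M W ζ) y − ζ y) ≤ M²·Σ_yΣ_μ nhsNormSq (gaugeDir W ζ y μ)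
   + 4d(M(d−1)(M−1)a)²·Σ_y nhsNormSq (ζ y)`; **`sum_nhsNormSq_psiExt_bmeanIterW_sub_le`** (+ J2): with `M = L^{j+1}`,
   `Σ_y nhsNormSq (psiExt M W (bmeanIterW L (j+1) W ζ) y − ζ y) ≤ 2M²·Σ‖gaugeDir W ζ‖² + (8d(M(d−1)(M−1)x)² + 2·card n·E_j²)·Σ‖ζ‖²`,
   `E_j = 4d²(M−1)²x + 16d·loopRad d L ((prop1Radius d L)^[j] x)` (J2's constant of record);
§3 **`abs_sum_hsR_rho_psiExt_le`** — THE `R_ρ` BOUND: for ANY site field `ρ` with `Σ_y hsR (ζ′ y) (ρ y) = 0` (K1-inst (S2)(iii)),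
   `|Σ_y hsR (ρ y) (psiExt M W (bmeanIterW L (j+1) W ζ′) y)| ≤ √(Σ nhsNormSq ρ)·√(2M²·Σ‖gaugeDir W ζ′‖² + (8d(M(d−1)(M−1)x)² + 2·card n·E_j²)·Σ‖ζ′‖²)`
   — with ρ² ≤ (ε∕M)²y², Σ‖gaugeDir W ζ′‖² ≤ y², Σ‖ζ′‖² ≤ (M∕ε)²y² this is the blueprint's `O(ε)·y²` (`θ = M²x ≤ cε²`, `E_j ≤ cε²`); K6c does the arithmetic.
HONEST FRAMING.  Bookkeeping on OUR lattice objects at ONE unitary background in the small-field class; nothing about Bałaban's minimisers;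
(P♮)_W, (ML_w) at `W ≠ 1`, T-E_w and NE3 are NOT proved; spine PROVED 0∕9; finite T⁴ rung (B)+1 — NOT infinite volume, NOT mass gap, NOT
BetaPertH, NOT Clay.  ABSOLUTE RULE kept: no printed sentence is a hypothesis (context only: [Balaban1985Averaging] (42)–(48) pp. 23–25;
[Balaban1985Variational] (83) p. 290).  PLACEMENT: `Summits/QuantumFields/BalabanUV/`; imports accepted modules only; moves nothing.
HONEST DEPENDENCY: continuum YM on T⁴ ⇐ BetaPertH ∧ nine spine estimates (0/9 proved); BetaPertH ⇐ (D1) ∧ (D4) ∧ CAP+tail; G-an2-4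
gates asym, D1 and NE2/3/4.
-/

set_option autoImplicit false

open scoped BigOperators Matrix.Norms.L2Operator
open Finset

namespace Summit.QuantumFields.BalabanUV.T4Continuum.NE3SlicePoincareRemainderRho

open Literature.MathematicalPhysics.QuantumFieldTheory.Balaban1983to89
open B7Prop1Explicit B7Prop2Explicit MatrixNorms
open T4AveragingDeficitWall (IsUnitaryCfg SmallField Ad)
open T4AveragingDeficitWallBoundary (periodBox mem_periodBox card_periodBox)
open T4AveragingDeficitNonAbelian (Ad_sub)
open AveragingDeficitHSInner (nhsNormSq_Ad)
open AveragingDeficitBlockDensity (btree btree_mem)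
open AveragingDeficitTwoLevelPrep (prop1Radius)
open AveragingDeficitMultiLevelPrep (LevelSmall)
open SpreadLift (loopRad)
open BlockAveragePushDirGauge (gaugeDir)
open NE3BlockLineAverage (sum_periodBox_blocks)
open NE3CovariantCalculus (hsR hsR_add_right hsR_sub_right hsR_comm nhsNormSq_sub_le nhsNormSq_neg)
open NE3CovariantBlockMean (bmeanW bmeanIterW)
open NE3CovariantBlockPoincare (sum_nhsNormSq_sub_combMean_le)
open NE3NestedBlockMeanBridge (sum_nhsNormSq_bmeanIterW_sub_bmeanW_le)
open NE3CovariantLandauKill (psiExt)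
open NE3SlicePoincareSkeleton (abs_sum_hsR_le)
open SkeletonLattice (cdiv cdiv_eq_of_repr)

noncomputable section

variable {d : ℕ} {n : Type*} [Fintype n] [DecidableEq n]

/-! ## §1 `psiExt` algebra -/

/-- `psiExt` is subtractive in the coarse field. [folklore] -/
theorem psiExt_sub (M : ℕ) (W : Site d → Fin d → (Matrix n n ℂ)ˣ) (ψ₁ ψ₂ : Site d → Matrix n n ℂ) (y : Site d) :
    psiExt M W ψ₁ y - psiExt M W ψ₂ y = psiExt M W (fun z => ψ₁ z - ψ₂ z) y := by
  simp only [psiExt, Ad_sub]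

/-- On the block of `z`: `psiExt M W ψ (M•z + v) = Ad (btree M W z (M•z + v))⁻¹ (ψ z)` for `v ∈ [0,M)^d`. [folklore] -/
theorem psiExt_block (M : ℕ) (W : Site d → Fin d → (Matrix n n ℂ)ˣ) (ψ : Site d → Matrix n n ℂ) (z : Site d) {v : Site d}
    (hv : v ∈ periodBox (d := d) M) :
    psiExt M W ψ ((M : ℤ) • z + v) = Ad (btree M W z ((M : ℤ) • z + v))⁻¹ (ψ z) := by
  have hcd : cdiv M ((M : ℤ) • z + v) = z :=
    cdiv_eq_of_repr (L := M) rfl (fun i => (mem_periodBox.1 hv i).1) (fun i => (mem_periodBox.1 hv i).2)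
  simp only [psiExt, hcd]

/-- **THE TRANSPORT IS AN HS ISOMETRY, BLOCK BY BLOCK**: for unitary `W` and `M ≥ 1`,
`Σ_{y∈periodBox(M·N)} nhsNormSq (psiExt M W ψ₁ y − psiExt M W ψ₂ y) = Σ_{z∈periodBox N} M^d·nhsNormSq (ψ₁ z − ψ₂ z)`. [folklore] -/
theorem sum_nhsNormSq_psiExt_sub_psiExt {M : ℕ} (hM : 1 ≤ M) (N : ℕ) {W : Site d → Fin d → (Matrix n n ℂ)ˣ} (hWu : IsUnitaryCfg W)
    (ψ₁ ψ₂ : Site d → Matrix n n ℂ) :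
    ∑ y ∈ periodBox (d := d) (M * N), nhsNormSq (psiExt M W ψ₁ y - psiExt M W ψ₂ y)
      = ∑ z ∈ periodBox (d := d) N, (M : ℝ) ^ d * nhsNormSq (ψ₁ z - ψ₂ z) := by
  rw [← sum_periodBox_blocks M N hM]
  refine Finset.sum_congr rfl fun z _ => ?_
  have hpt : ∀ v ∈ periodBox (d := d) M,
      nhsNormSq (psiExt M W ψ₁ ((M : ℤ) • z + v) - psiExt M W ψ₂ ((M : ℤ) • z + v)) = nhsNormSq (ψ₁ z - ψ₂ z) := by
    intro v hv
    rw [psiExt_sub, psiExt_block M W _ z hv, nhsNormSq_Ad ((unitaryUnits (Matrix n n ℂ)).inv_mem (btree_mem hWu M z _))]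
  rw [Finset.sum_congr rfl hpt, Finset.sum_const, card_periodBox, nsmul_eq_mul]
  push_cast
  ring

/-! ## §2 K2 and J2 tiled over the torus -/

/-- **K2 TILED OVER THE TORUS**: for unitary small-field `W` (`0 ≤ a`, `SmallField W a`), `M ≥ 1`, ANY `ζ`:
`Σ_{y∈periodBox(M·N)} nhsNormSq (psiExt M W (bmeanW M W ζ) y − ζ y) ≤ M²·Σ_yΣ_μ nhsNormSq (gaugeDir W ζ y μ) + 4d(M(d−1)(M−1)a)²·Σ_y nhsNormSq (ζ y)`
(leaf-04's `sum_nhsNormSq_sub_combMean_le` block by block). [folklore] -/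
theorem sum_nhsNormSq_psiExt_bmeanW_sub_le [Nonempty n] {M : ℕ} (hM : 1 ≤ M) (N : ℕ) {W : Site d → Fin d → (Matrix n n ℂ)ˣ}
    (hWu : IsUnitaryCfg W) {a : ℝ} (ha : 0 ≤ a) (hWa : SmallField W a) (ζ : Site d → Matrix n n ℂ) :
    ∑ y ∈ periodBox (d := d) (M * N), nhsNormSq (psiExt M W (bmeanW M W ζ) y - ζ y)
      ≤ (M : ℝ) ^ 2 * ∑ y ∈ periodBox (d := d) (M * N), ∑ μ : Fin d, nhsNormSq (gaugeDir W ζ y μ)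
        + 4 * d * ((M : ℝ) * (((d : ℝ) - 1) * ((M : ℝ) - 1) * a)) ^ 2 * ∑ y ∈ periodBox (d := d) (M * N), nhsNormSq (ζ y) := by
  rw [← sum_periodBox_blocks M N hM, ← sum_periodBox_blocks M N hM (fun y => ∑ μ : Fin d, nhsNormSq (gaugeDir W ζ y μ)),
    ← sum_periodBox_blocks M N hM (fun y => nhsNormSq (ζ y)), Finset.mul_sum, Finset.mul_sum, ← Finset.sum_add_distrib]
  refine Finset.sum_le_sum fun z _ => ?_
  have hK2 := sum_nhsNormSq_sub_combMean_le hM hWu ha hWa ζ z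
  have hpt : ∀ v ∈ periodBox (d := d) M,
      nhsNormSq (psiExt M W (bmeanW M W ζ) ((M : ℤ) • z + v) - ζ ((M : ℤ) • z + v))
        = nhsNormSq (ζ ((M : ℤ) • z + v) - Ad (btree M W z ((M : ℤ) • z + v))⁻¹ (bmeanW M W ζ z)) := by
    intro v hv
    rw [psiExt_block M W _ z hv, ← nhsNormSq_neg, neg_sub]
  rw [Finset.sum_congr rfl hpt]
  exact hK2

/-- **K2 + J2**: with `M = L^{j+1}` (`L ≥ 2`), unitary `W`, `0 ≤ x`, `LevelSmall d L j x`, `SmallField W x`, ANY `ζ`: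
`Σ_y nhsNormSq (psiExt M W (bmeanIterW L (j+1) W ζ) y − ζ y) ≤ 2M²·Σ_yΣ_μ nhsNormSq (gaugeDir W ζ y μ)
  + (8d(M(d−1)(M−1)x)² + 2·card n·E_j²)·Σ_y nhsNormSq (ζ y)`, `E_j = 4d²(M−1)²x + 16d·loopRad d L ((prop1Radius d L)^[j] x)`. [folklore] -/
theorem sum_nhsNormSq_psiExt_bmeanIterW_sub_le [Nonempty n] {L : ℕ} (hL : 2 ≤ L) (j N : ℕ) {W : Site d → Fin d → (Matrix n n ℂ)ˣ}
    (hWu : IsUnitaryCfg W) {x : ℝ} (hx : 0 ≤ x) (hsm : LevelSmall d L j x) (hWx : SmallField W x) (ζ : Site d → Matrix n n ℂ) :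
    ∑ y ∈ periodBox (d := d) (L ^ (j + 1) * N), nhsNormSq (psiExt (L ^ (j + 1)) W (bmeanIterW L (j + 1) W ζ) y - ζ y)
      ≤ 2 * ((L : ℝ) ^ (j + 1)) ^ 2 * ∑ y ∈ periodBox (d := d) (L ^ (j + 1) * N), ∑ μ : Fin d, nhsNormSq (gaugeDir W ζ y μ)
        + (8 * d * (((L : ℝ) ^ (j + 1)) * (((d : ℝ) - 1) * (((L : ℝ) ^ (j + 1)) - 1) * x)) ^ 2
            + 2 * (Fintype.card n * (4 * (d : ℝ) ^ 2 * ((L : ℝ) ^ (j + 1) - 1) ^ 2 * x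
                + 16 * d * loopRad d L ((prop1Radius d L)^[j] x)) ^ 2))
          * ∑ y ∈ periodBox (d := d) (L ^ (j + 1) * N), nhsNormSq (ζ y) := by
  set M : ℕ := L ^ (j + 1) with hMdef
  have hM : 1 ≤ M := Nat.one_le_pow _ _ (by omega)
  have hMR : (M : ℝ) = (L : ℝ) ^ (j + 1) := by rw [hMdef]; push_cast; ring
  -- split `psiExt ψ − ζ = (psiExt ψ − psiExt m₁) + (psiExt m₁ − ζ)` with `m₁ = bmeanW M W ζ`
  have hsplit : ∀ y : Site d, psiExt M W (bmeanIterW L (j + 1) W ζ) y - ζ y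
      = (psiExt M W (bmeanIterW L (j + 1) W ζ) y - psiExt M W (bmeanW M W ζ) y) - (ζ y - psiExt M W (bmeanW M W ζ) y) := fun y => by abel
  have h2 : ∀ y : Site d, nhsNormSq (psiExt M W (bmeanIterW L (j + 1) W ζ) y - ζ y)
      ≤ 2 * (nhsNormSq (psiExt M W (bmeanIterW L (j + 1) W ζ) y - psiExt M W (bmeanW M W ζ) y)
        + nhsNormSq (psiExt M W (bmeanW M W ζ) y - ζ y)) := by
    intro y
    rw [hsplit y]
    refine (nhsNormSq_sub_le _ _).trans ?_
    rw [← nhsNormSq_neg (ζ y - psiExt M W (bmeanW M W ζ) y), neg_sub]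
  -- the two pieces
  have hA : ∑ y ∈ periodBox (d := d) (M * N), nhsNormSq (psiExt M W (bmeanIterW L (j + 1) W ζ) y - psiExt M W (bmeanW M W ζ) y)
      ≤ Fintype.card n * (4 * (d : ℝ) ^ 2 * ((L : ℝ) ^ (j + 1) - 1) ^ 2 * x + 16 * d * loopRad d L ((prop1Radius d L)^[j] x)) ^ 2
        * ∑ y ∈ periodBox (d := d) (L ^ (j + 1) * N), nhsNormSq (ζ y) := by
    rw [sum_nhsNormSq_psiExt_sub_psiExt hM N hWu]
    have hJ2 := sum_nhsNormSq_bmeanIterW_sub_bmeanW_le hL j hWu hx hsm hWx ζ N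
    simp only [hMR]
    exact hJ2
  have hB := sum_nhsNormSq_psiExt_bmeanW_sub_le hM N hWu hx hWx ζ
  calc ∑ y ∈ periodBox (d := d) (M * N), nhsNormSq (psiExt M W (bmeanIterW L (j + 1) W ζ) y - ζ y)
      ≤ ∑ y ∈ periodBox (d := d) (M * N), 2 * (nhsNormSq (psiExt M W (bmeanIterW L (j + 1) W ζ) y - psiExt M W (bmeanW M W ζ) y)
          + nhsNormSq (psiExt M W (bmeanW M W ζ) y - ζ y)) := Finset.sum_le_sum fun y _ => h2 y
    _ = 2 * ∑ y ∈ periodBox (d := d) (M * N), nhsNormSq (psiExt M W (bmeanIterW L (j + 1) W ζ) y - psiExt M W (bmeanW M W ζ) y)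
        + 2 * ∑ y ∈ periodBox (d := d) (M * N), nhsNormSq (psiExt M W (bmeanW M W ζ) y - ζ y) := by
        rw [Finset.mul_sum, Finset.mul_sum, ← Finset.sum_add_distrib]
        exact Finset.sum_congr rfl fun y _ => by ring
    _ ≤ _ := by rw [hMR] at hB; rw [hMdef]; nlinarith [hA, hB]

/-! ## §3 The `R_ρ` bound -/

/-- **THE `R_ρ` PAIRING** (blueprint ρ-g23-3 §2(a)): with `M = L^{j+1}`, unitary `W`, `0 ≤ x`, `LevelSmall d L j x`, `SmallField W x`, and ANY
site field `ρ` which is `hsR`-orthogonal to `ζ′` over the period box (K1-inst (S2)(iii): `ρ = covDiv W η′ = D_W†D_W c̃`, `ζ′ = cutHigh`),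
`|Σ_y hsR (ρ y) (psiExt M W (bmeanIterW L (j+1) W ζ′) y)| ≤ √(Σ nhsNormSq ρ)·√(2M²·Σ‖gaugeDir W ζ′‖² + (8d(M(d−1)(M−1)x)² + 2·card n·E_j²)·Σ‖ζ′‖²)`. [folklore] -/
theorem abs_sum_hsR_rho_psiExt_le [Nonempty n] {L : ℕ} (hL : 2 ≤ L) (j N : ℕ) {W : Site d → Fin d → (Matrix n n ℂ)ˣ}
    (hWu : IsUnitaryCfg W) {x : ℝ} (hx : 0 ≤ x) (hsm : LevelSmall d L j x) (hWx : SmallField W x)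
    (ρ ζ' : Site d → Matrix n n ℂ) (horth : ∑ y ∈ periodBox (d := d) (L ^ (j + 1) * N), hsR (ζ' y) (ρ y) = 0) :
    |∑ y ∈ periodBox (d := d) (L ^ (j + 1) * N), hsR (ρ y) (psiExt (L ^ (j + 1)) W (bmeanIterW L (j + 1) W ζ') y)|
      ≤ Real.sqrt (∑ y ∈ periodBox (d := d) (L ^ (j + 1) * N), nhsNormSq (ρ y))
        * Real.sqrt (2 * ((L : ℝ) ^ (j + 1)) ^ 2 * ∑ y ∈ periodBox (d := d) (L ^ (j + 1) * N), ∑ μ : Fin d, nhsNormSq (gaugeDir W ζ' y μ)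
          + (8 * d * (((L : ℝ) ^ (j + 1)) * (((d : ℝ) - 1) * (((L : ℝ) ^ (j + 1)) - 1) * x)) ^ 2
              + 2 * (Fintype.card n * (4 * (d : ℝ) ^ 2 * ((L : ℝ) ^ (j + 1) - 1) ^ 2 * x
                  + 16 * d * loopRad d L ((prop1Radius d L)^[j] x)) ^ 2))
            * ∑ y ∈ periodBox (d := d) (L ^ (j + 1) * N), nhsNormSq (ζ' y)) := by
  set P : ℕ := L ^ (j + 1) * N with hP
  set ψ := bmeanIterW L (j + 1) W ζ' with hψ
  -- the orthogonality removes `ζ′` from the pairing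
  have hshift : ∑ y ∈ periodBox (d := d) P, hsR (ρ y) (psiExt (L ^ (j + 1)) W ψ y)
      = ∑ y ∈ periodBox (d := d) P, hsR (ρ y) (psiExt (L ^ (j + 1)) W ψ y - ζ' y) := by
    have h0 : ∑ y ∈ periodBox (d := d) P, hsR (ρ y) (ζ' y) = 0 := by
      rw [← horth]; exact Finset.sum_congr rfl fun y _ => hsR_comm _ _
    have : ∑ y ∈ periodBox (d := d) P, hsR (ρ y) (psiExt (L ^ (j + 1)) W ψ y - ζ' y)
        = ∑ y ∈ periodBox (d := d) P, hsR (ρ y) (psiExt (L ^ (j + 1)) W ψ y) - ∑ y ∈ periodBox (d := d) P, hsR (ρ y) (ζ' y) := by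
      rw [← Finset.sum_sub_distrib]
      exact Finset.sum_congr rfl fun y _ => hsR_sub_right _ _ _
    rw [this, h0, sub_zero]
  rw [hshift]
  refine (abs_sum_hsR_le (d := d) P ρ _).trans ?_
  refine mul_le_mul_of_nonneg_left (Real.sqrt_le_sqrt ?_) (Real.sqrt_nonneg _)
  exact sum_nhsNormSq_psiExt_bmeanIterW_sub_le hL j N hWu hx hsm hWx ζ'

end

end Summit.QuantumFields.BalabanUV.T4Continuum.NE3SlicePoincareRemainderRho
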